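import Mathlib.Algebra.CharP.Two
import Mathlib.Data.ZMod.Basic
import Mathlib.Algebra.BigOperators.Intervals
import Mathlib.SetTheory.Cardinal.Finite
import Mathlib.Logic.Equiv.Fin.Basic
import Literature.Computability.MetaComplexity.CMMSA
import HarnessLib

/-!
# Cryptography: secret sharing schemes and the Benaloh–Leichter scheme for monotone DNFs

Support for the NP-hardness of the partial-function Minimum Circuit Size Problem `MCSP*`
(`Literature.Computability.Complexity.isRandNPHard_MCSPStar`; Hirahara, FOCS 2022, Thm. 1.2 = Thm. 8.5 of ECCC TR22-119):
the randomized reduction from the gap problem `gapCMMSA` (`MetaComplexity/CMMSA.lean`) to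
`MCSP*` (Hirahara 2022, Lemma 8.3) shares a secret bit among the variables of a monotone DNF
formula `φⱼ` of the CMMSA instance with a secret sharing scheme for the access structure
represented by `φⱼ` (Hirahara 2022, §4.2, Lemma 4.5). This file vendors

* `AccessStructure P` — Def. 4.3: a monotone family of (finite) sets of parties;
  `MonotoneDNF.accessStructure φ` — the access structure represented by a monotone DNF
  (`T` authorized iff `φ(χ_T) = 1`, `mem_accessStructure_iff_eval`);
* `SecretSharingScheme P` — Def. 4.4: finite coin space, `share : secret → coins → party →
  {0,1}*`, `reconstruct : set of parties → shares → secret`; the predicates `Correct`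
  (authorized sets reconstruct with probability `1`), `Private` (perfect privacy: for an
  unauthorized `T` the views `Share(1)_T` and `Share(0)_T` are identically distributed),
  `IsSchemeFor`; `private_iff_exists_equiv` (privacy iff a bijection of the coin space
  transports one view to the other) and the event form `Private.card_event_eq`;
* the **Benaloh–Leichter scheme** `MonotoneDNF.blScheme φ` of a monotone DNF (an OR gate
  replicates the secret, an AND gate `x_{i₁} ∧ ⋯ ∧ x_{i_t}` splits it additively over `𝔽₂`:
  position `0` of a term carries `b + Σ_{q ≥ 1} r_q`, position `q ≥ 1` the coin `r_q`; party
  `i` receives the symbols at the occurrences of `xᵢ`), with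
  **Lemma 4.5 proved for DNFs**: `BenalohLeichter.correct`, `BenalohLeichter.private_`
  (via the coin involution `BenalohLeichter.flip`), the share-length bound
  `length_share_le` (`|sᵢ| ≤ |φ|`) and the `GF(2)`-linearity of reconstruction
  `reconstruct_linear`; packaged as `MonotoneDNF.exists_secretSharingScheme`.

## Design choices

* Perfect schemes with uniform coins over a `Fintype`: privacy is stated by counting coin
  outcomes (`Nat.card` of fibres), which is "`b` and `Share(b)_T` are independent for every
  random variable `b`" of Def. 4.4 for perfect schemes; no `PMF` is needed, and
  `private_iff_exists_equiv` converts to the transport form used in hybrid arguments.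
* Shares are bit strings `List Bool` (Def. 4.4: "a sequence of `n` strings"); the view of a set
  `T` is `restrictShares T s` (shares outside `T` blanked), so `reconstruct T` provably reads
  only `s_T`.
* Lemma 4.5 is printed for all monotone formulas; it is proved here for monotone DNF formulas
  (`MonotoneDNF = List (List ℕ)` of `CMMSA.lean`), the case consumed by Lemma 8.3 on the DNF
  collections of Thm. 5.2 (`gapCMMSA` only represents DNF collections). The empty conjunction
  is excluded in the correctness statement (`[] ∉ φ`): it is not a formula over literals, and
  with it the empty coalition would be authorized.
* The polynomial running times of `Share`/`Rec` in Lemma 4.5 are witnessed by the explicit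
  one-pass maps and are not restated as machine bounds; what Lemma 8.3 uses is the explicit
  form: `|sᵢ| ≤ |φ|` and `Rec(φ, T, -)` an XOR of at most `|φ|` share bits.
* Mathlib has no secret sharing or access structures (searched `secret`, `AccessStructure`,
  `Shamir`, `Benaloh`); nothing is duplicated. `ZMod 2` carries the `GF(2)` arithmetic
  (`bitZ`/`zBit` convert bits).

## References

* S. Hirahara, *NP-hardness of learning programs and partial MCSP*, FOCS 2022; ECCC TR22-119
  (numbering used here): Def. 4.3, Def. 4.4, Lemma 4.5 (pp. 14–15), Lemma 8.3 (pp. 26–29).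
* J. Benaloh, J. Leichter, *Generalized secret sharing and monotone functions*, CRYPTO 1988,
  LNCS 403, pp. 27–35 (the scheme for monotone formulas).
* M. Ito, A. Saito, T. Nishizeki, *Secret sharing scheme realizing general access structure*,
  Electronics and Communications in Japan 72 (1989) / J. Cryptology 6 (1993).
* A. Beimel, *Secret-sharing schemes: a survey*, IWCC 2011, LNCS 6639, Def. 2–3 and §3.2.
-/

namespace Literature.Computability.Cryptography

/-! ### Access structures (Hirahara 2022, Def. 4.3) -/

/-- An **access structure** on a set of parties `P` (Hirahara 2022, Def. 4.3; Beimel 2011): a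
monotone (upward closed) collection of finite sets of parties, the *authorized* sets.
[cite: Hirahara2022PartialMCSP, Def. 4.3] -/
structure AccessStructure (P : Type) where
  /-- The authorized sets of parties. -/
  authorized : Set (Finset P)
  /-- Monotonicity: supersets of authorized sets are authorized. -/
  mono' : ∀ ⦃S T : Finset P⦄, S ∈ authorized → S ⊆ T → T ∈ authorized

namespace AccessStructure

variable {P : Type}

/-- Supersets of authorized sets are authorized. [cite: Hirahara2022PartialMCSP, Def. 4.3] -/
theorem mono (A : AccessStructure P) {S T : Finset P} (hS : S ∈ A.authorized) (hST : S ⊆ T) :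
    T ∈ A.authorized :=
  A.mono' hS hST

end AccessStructure

/-! ### Secret sharing schemes (Hirahara 2022, Def. 4.4) -/

/-- The shares seen by a set `T` of parties: the shares of the parties outside `T` are blanked
(replaced by the empty string). (`Share(b)_T` in Def. 4.4.) [cite: Hirahara2022PartialMCSP, Def. 4.4] -/
def restrictShares {P : Type} [DecidableEq P] (T : Finset P) (s : P → List Bool) :
    P → List Bool :=
  fun p => if p ∈ T then s p else []

/-- On a party of `T`, the restricted shares are the shares. [cite: Hirahara2022PartialMCSP, Def. 4.4] -/
@[simp] theorem restrictShares_of_mem {P : Type} [DecidableEq P] {T : Finset P} {p : P}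
    (s : P → List Bool) (hp : p ∈ T) : restrictShares T s p = s p := by
  simp [restrictShares, hp]

/-- Outside `T`, the restricted shares are blank. [cite: Hirahara2022PartialMCSP, Def. 4.4] -/
@[simp] theorem restrictShares_of_not_mem {P : Type} [DecidableEq P] {T : Finset P} {p : P}
    (s : P → List Bool) (hp : p ∉ T) : restrictShares T s p = [] := by
  simp [restrictShares, hp]

/-- Two share vectors have the same restriction to `T` iff they agree on `T`. [folklore] -/
theorem restrictShares_eq_iff {P : Type} [DecidableEq P] (T : Finset P) (s s' : P → List Bool) :
    restrictShares T s = restrictShares T s' ↔ ∀ p ∈ T, s p = s' p := by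
  constructor
  · intro h p hp
    have := congrFun h p
    simpa [restrictShares, hp] using this
  · intro h
    funext p
    by_cases hp : p ∈ T
    · simp [restrictShares, hp, h p hp]
    · simp [restrictShares, hp]

/-- A (one-bit, perfect) **secret sharing scheme** for parties `P` (Hirahara 2022, Def. 4.4;
Beimel 2011): a finite nonempty space `Rand` of internal randomness of the sharing algorithm
(sampled uniformly), the sharing map `share b r : P → List Bool` (the share `sᵢ ∈ {0,1}*` of
each party for the secret `b` and coins `r`), and the deterministic reconstruction map
`reconstruct T s_T : Bool` from a set of parties `T` and the shares it sees. Correctness and privacy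
with respect to an access structure are the predicates `Correct` and `Private` (`IsSchemeFor`
for both). [cite: Hirahara2022PartialMCSP, Def. 4.4] -/
structure SecretSharingScheme (P : Type) [DecidableEq P] where
  /-- The (finite, nonempty) space of internal randomness of `Share`, sampled uniformly. -/
  Rand : Type
  [instFintype : Fintype Rand]
  [instNonempty : Nonempty Rand]
  /-- `share b r p`: the share of party `p` when the secret `b` is shared with coins `r`. -/
  share : Bool → Rand → P → List Bool
  /-- `reconstruct T s`: the secret reconstructed by the set of parties `T` from the shares `s`
  (only the shares of parties in `T` are available, cf. `Correct`). -/
  reconstruct : Finset P → (P → List Bool) → Bool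

namespace SecretSharingScheme

variable {P : Type} [DecidableEq P]

/-- The coin space of a scheme is finite. [cite: Hirahara2022PartialMCSP, Def. 4.4] -/
instance fintypeRand (S : SecretSharingScheme P) : Fintype S.Rand := S.instFintype

/-- The coin space of a scheme is nonempty. [cite: Hirahara2022PartialMCSP, Def. 4.4] -/
instance nonemptyRand (S : SecretSharingScheme P) : Nonempty S.Rand := S.instNonempty

/-- **Correctness** (Def. 4.4): every authorized set `T` reconstructs the secret from the
shares it sees, for every secret and with probability `1` over the coins of `Share`.
[cite: Hirahara2022PartialMCSP, Def. 4.4 (Correctness)] -/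
def Correct (S : SecretSharingScheme P) (A : AccessStructure P) : Prop :=
  ∀ T ∈ A.authorized, ∀ (b : Bool) (r : S.Rand), S.reconstruct T (restrictShares T (S.share b r)) = b

/-- **Privacy** (Def. 4.4, perfect privacy): for every unauthorized set `T`, the shares seen by
`T` when sharing the secret `1` and when sharing the secret `0` are identically distributed over
the uniform coins of `Share` — every value `v` of `Share(b)_T` has the same number of coin
outcomes producing it for `b = 1` and for `b = 0`. Equivalently (Def. 4.4 as printed), for every
random variable `b` on `{0,1}` the random variables `b` and `Share(b)_T` are independent; and
equivalently some bijection of the coin space transports `Share(1)_T` to `Share(0)_T`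
(`private_iff_exists_equiv`). [cite: Hirahara2022PartialMCSP, Def. 4.4 (Privacy)] -/
def Private (S : SecretSharingScheme P) (A : AccessStructure P) : Prop :=
  ∀ T ∉ A.authorized, ∀ v : P → List Bool,
    Nat.card {r : S.Rand // restrictShares T (S.share true r) = v} =
      Nat.card {r : S.Rand // restrictShares T (S.share false r) = v}

/-- `S` **is a secret sharing scheme for** the access structure `A`: correctness and privacy
(Def. 4.4). [cite: Hirahara2022PartialMCSP, Def. 4.4] -/
def IsSchemeFor (S : SecretSharingScheme P) (A : AccessStructure P) : Prop :=
  S.Correct A ∧ S.Private A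

/-- A bijection `Ψ` of the coin space with `Share(0)_T ∘ Ψ = Share(1)_T` for every unauthorized
`T` witnesses privacy (the two views are then identically distributed). [cite: Hirahara2022PartialMCSP, Def. 4.4 (Privacy)] -/
theorem private_of_equiv (S : SecretSharingScheme P) (A : AccessStructure P)
    (h : ∀ T ∉ A.authorized, ∃ Ψ : S.Rand ≃ S.Rand, ∀ r,
      restrictShares T (S.share false (Ψ r)) = restrictShares T (S.share true r)) :
    S.Private A := by
  intro T hT v
  obtain ⟨Ψ, hΨ⟩ := h T hT
  refine Nat.card_congr (Ψ.subtypeEquiv fun r => ?_)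
  rw [hΨ r]

/-- **Privacy is equidistribution by a coin bijection**: `S` is private for `A` iff for every
unauthorized `T` some bijection `Ψ` of the coin space satisfies `Share(0)_T ∘ Ψ = Share(1)_T`
(glue fibrewise bijections, which exist by the equality of the fibre cardinalities).
[cite: Hirahara2022PartialMCSP, Def. 4.4 (Privacy)] -/
theorem private_iff_exists_equiv (S : SecretSharingScheme P) (A : AccessStructure P) :
    S.Private A ↔ ∀ T ∉ A.authorized, ∃ Ψ : S.Rand ≃ S.Rand, ∀ r,
      restrictShares T (S.share false (Ψ r)) = restrictShares T (S.share true r) := by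
  refine ⟨fun h T hT => ?_, S.private_of_equiv A⟩
  classical
  let f : S.Rand → (P → List Bool) := fun r => restrictShares T (S.share true r)
  let g : S.Rand → (P → List Bool) := fun r => restrictShares T (S.share false r)
  have hfib : ∀ v, Nonempty ({r // f r = v} ≃ {r // g r = v}) := fun v =>
    Finite.card_eq.1 (h T hT v)
  let e : ∀ v, {r // f r = v} ≃ {r // g r = v} := fun v => (hfib v).some
  exact ⟨Equiv.ofFiberEquiv e, fun r => Equiv.ofFiberEquiv_map e r⟩

/-- Privacy, event form: for an unauthorized `T`, every event about the shares seen by `T` has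
the same number of favourable coin outcomes whether the secret is `1` or `0` (so the same
probability under the uniform coins). [cite: Hirahara2022PartialMCSP, Def. 4.4 (Privacy)] -/
theorem Private.card_event_eq {S : SecretSharingScheme P} {A : AccessStructure P}
    (h : S.Private A) {T : Finset P} (hT : T ∉ A.authorized) (E : Set (P → List Bool)) :
    Nat.card {r : S.Rand // restrictShares T (S.share true r) ∈ E} =
      Nat.card {r : S.Rand // restrictShares T (S.share false r) ∈ E} := by
  obtain ⟨Ψ, hΨ⟩ := (S.private_iff_exists_equiv A).1 h T hT
  refine Nat.card_congr (Ψ.subtypeEquiv fun r => ?_)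
  rw [hΨ r]

end SecretSharingScheme

end Literature.Computability.Cryptography

namespace Literature.Computability.Cryptography


section MonotoneDNF
open Literature.Computability.MetaComplexity (MonotoneDNF)
open Literature.Computability.MetaComplexity.MonotoneDNF

/-! ### The access structure of a monotone DNF -/

/-- The access structure **represented by** a monotone DNF `φ` (Def. 4.3: "`f` represents `𝒜`
if `f(χ_T) = 1 ⇔ T ∈ 𝒜`"): `T` is authorized iff some term of `φ` has all its variables in
`T`, i.e. iff `φ(χ_T) = 1` (`mem_accessStructure_iff_eval`). [cite: Hirahara2022PartialMCSP, Def. 4.3] -/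
def _root_.Literature.Computability.MetaComplexity.MonotoneDNF.accessStructure (φ : MonotoneDNF) : AccessStructure ℕ where
  authorized := {T | ∃ t ∈ φ, ∀ i ∈ t, i ∈ T}
  mono' := by
    rintro S T ⟨t, ht, hS⟩ hST
    exact ⟨t, ht, fun i hi => hST (hS i hi)⟩

/-- `T` is authorized for `φ` iff some term of `φ` is contained in `T`. [cite: Hirahara2022PartialMCSP, Def. 4.3] -/
theorem _root_.Literature.Computability.MetaComplexity.MonotoneDNF.mem_accessStructure_iff (φ : MonotoneDNF) (T : Finset ℕ) :
    T ∈ φ.accessStructure.authorized ↔ ∃ t ∈ φ, ∀ i ∈ t, i ∈ T := Iff.rfl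

/-- `T` is authorized for `φ` iff `φ(χ_T) = 1`. [cite: Hirahara2022PartialMCSP, Def. 4.3] -/
theorem _root_.Literature.Computability.MetaComplexity.MonotoneDNF.mem_accessStructure_iff_eval (φ : MonotoneDNF) (T : Finset ℕ) :
    T ∈ φ.accessStructure.authorized ↔ φ.eval (fun i => decide (i ∈ T)) = true := by
  rw [eval_eq_true_iff, mem_accessStructure_iff]
  simp

/-! ### Occurrences of literals -/

/-- The variable at an occurrence `(k, p)` (term index `k`, position `p` inside the term);
`0` out of range. [folklore] -/
def _root_.Literature.Computability.MetaComplexity.MonotoneDNF.varAt (φ : MonotoneDNF) (kp : ℕ × ℕ) : ℕ :=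
  (φ.getD kp.1 []).getD kp.2 0

/-- The length of the `k`-th term (`0` out of range). [folklore] -/
def _root_.Literature.Computability.MetaComplexity.MonotoneDNF.termLen (φ : MonotoneDNF) (k : ℕ) : ℕ :=
  (φ.getD k []).length

/-- The list of all literal occurrences `(k, p)`, `k < |φ|`, `p < |φ[k]|`, in lexicographic
order. [folklore] -/
def _root_.Literature.Computability.MetaComplexity.MonotoneDNF.occs (φ : MonotoneDNF) : List (ℕ × ℕ) :=
  (List.range φ.length).flatMap fun k => (List.range (φ.termLen k)).map fun p => (k, p)

/-- The occurrences of the variable `i`, in lexicographic order. [folklore] -/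
def _root_.Literature.Computability.MetaComplexity.MonotoneDNF.occsOf (φ : MonotoneDNF) (i : ℕ) : List (ℕ × ℕ) :=
  φ.occs.filter fun kp => φ.varAt kp = i

/-- Membership in the occurrence list. [folklore] -/
@[simp] theorem _root_.Literature.Computability.MetaComplexity.MonotoneDNF.mem_occs (φ : MonotoneDNF) (kp : ℕ × ℕ) :
    kp ∈ φ.occs ↔ kp.1 < φ.length ∧ kp.2 < φ.termLen kp.1 := by
  obtain ⟨k, p⟩ := kp
  simp only [occs, List.mem_flatMap, List.mem_range, List.mem_map, Prod.mk.injEq]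
  constructor
  · rintro ⟨k', hk', p', hp', rfl, rfl⟩
    exact ⟨hk', hp'⟩
  · rintro ⟨hk, hp⟩
    exact ⟨k, hk, p, hp, rfl, rfl⟩

/-- Membership in the occurrence list of a variable. [folklore] -/
@[simp] theorem _root_.Literature.Computability.MetaComplexity.MonotoneDNF.mem_occsOf (φ : MonotoneDNF) (i : ℕ) (kp : ℕ × ℕ) :
    kp ∈ φ.occsOf i ↔ (kp.1 < φ.length ∧ kp.2 < φ.termLen kp.1) ∧ φ.varAt kp = i := by
  simp [occsOf]

/-- Auxiliary: summing a function of the entries over the index range is summing over the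
list. [folklore] -/
theorem _root_.Literature.Computability.MetaComplexity.MonotoneDNF.sum_map_range_getD {α : Type} (l : List α) (d : α) (g : α → ℕ) :
    ((List.range l.length).map fun k => g (l.getD k d)).sum = (l.map g).sum := by
  induction l with
  | nil => simp
  | cons a l ih =>
    rw [List.length_cons, List.range_succ_eq_map, List.map_cons, List.map_map, List.sum_cons,
      List.map_cons, List.sum_cons]
    show g a + ((List.range l.length).map fun k => g (l.getD k d)).sum = g a + (l.map g).sum
    rw [ih]

/-- The number of occurrences is the number `|φ|` of literals. [folklore] -/
theorem _root_.Literature.Computability.MetaComplexity.MonotoneDNF.length_occs (φ : MonotoneDNF) : φ.occs.length = φ.numLiterals := by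
  unfold occs numLiterals
  rw [List.length_flatMap]
  simp only [List.length_map, List.length_range]
  exact sum_map_range_getD φ [] List.length

/-- A variable occurs at most `|φ|` times. [folklore] -/
theorem _root_.Literature.Computability.MetaComplexity.MonotoneDNF.length_occsOf_le (φ : MonotoneDNF) (i : ℕ) : (φ.occsOf i).length ≤ φ.numLiterals := by
  rw [← length_occs]
  exact List.length_filter_le _ _

/-- Every term is at most as long as the literal count. [folklore] -/
theorem _root_.Literature.Computability.MetaComplexity.MonotoneDNF.termLen_le_numLiterals (φ : MonotoneDNF) (k : ℕ) : φ.termLen k ≤ φ.numLiterals := by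
  unfold termLen
  by_cases hk : k < φ.length
  · rw [List.getD_eq_getElem _ _ hk]
    unfold numLiterals
    exact List.le_sum_of_mem (List.mem_map.2 ⟨φ[k], List.getElem_mem hk, rfl⟩)
  · rw [List.getD_eq_default _ _ (not_lt.1 hk)]
    simp

/-- A term of a DNF without empty terms is nonempty. [folklore] -/
theorem _root_.Literature.Computability.MetaComplexity.MonotoneDNF.termLen_pos (φ : MonotoneDNF) (hφ : [] ∉ φ) {k : ℕ} (hk : k < φ.length) :
    0 < φ.termLen k := by
  unfold termLen
  rw [List.getD_eq_getElem _ _ hk]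
  refine List.length_pos_iff.2 fun h => hφ ?_
  rw [← h]
  exact List.getElem_mem hk

/-! ### Bits as elements of `𝔽₂` -/

/-- The embedding of bits into `𝔽₂`. [folklore] -/
def _root_.Literature.Computability.MetaComplexity.MonotoneDNF.bitZ (b : Bool) : ZMod 2 := if b then 1 else 0

/-- The bit of an element of `𝔽₂`. [folklore] -/
def _root_.Literature.Computability.MetaComplexity.MonotoneDNF.zBit (z : ZMod 2) : Bool := decide (z = 1)

/-- `zBit` inverts `bitZ`. [folklore] -/
@[simp] theorem _root_.Literature.Computability.MetaComplexity.MonotoneDNF.zBit_bitZ (b : Bool) : zBit (bitZ b) = b := by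
  cases b <;> decide

/-- `bitZ` inverts `zBit`. [folklore] -/
@[simp] theorem _root_.Literature.Computability.MetaComplexity.MonotoneDNF.bitZ_zBit (z : ZMod 2) : bitZ (zBit z) = z := by
  fin_cases z <;> decide

/-- Negation is adding `1` in `𝔽₂`. [folklore] -/
theorem _root_.Literature.Computability.MetaComplexity.MonotoneDNF.bitZ_not (b : Bool) : bitZ (!b) = bitZ b + 1 := by
  cases b <;> decide

/-- `bitZ 1 = 1`. [folklore] -/
@[simp] theorem _root_.Literature.Computability.MetaComplexity.MonotoneDNF.bitZ_true : bitZ true = 1 := rfl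

/-- `bitZ 0 = 0`. [folklore] -/
@[simp] theorem _root_.Literature.Computability.MetaComplexity.MonotoneDNF.bitZ_false : bitZ false = 0 := rfl

/-- List sums over `List.range` are `Finset.range` sums. [folklore] -/
theorem _root_.Literature.Computability.MetaComplexity.MonotoneDNF.sum_map_range_eq_finset_sum {M : Type} [AddCommMonoid M] (n : ℕ) (f : ℕ → M) :
    ((List.range n).map f).sum = ∑ p ∈ Finset.range n, f p := by
  induction n with
  | zero => simp
  | succ n ih => rw [List.range_succ, List.map_append, List.sum_append, ih,
      Finset.sum_range_succ, List.map_singleton, List.sum_singleton]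

/-! ### The Benaloh–Leichter scheme -/

section BenalohLeichter

/-- The coin space of the Benaloh–Leichter sharing algorithm for `φ`: one bit per pair
(term index, position) with positions `< |φ|` (only the bits at positions `1 ≤ p < |φ[k]|` are
used). [cite: Hirahara2022PartialMCSP, Lemma 4.5] -/
abbrev _root_.Literature.Computability.MetaComplexity.MonotoneDNF.BenalohLeichter.Rand (φ : MonotoneDNF) : Type := Fin φ.length × Fin φ.numLiterals → Bool

/-- The coin at `(k, p)` (`false` out of range). [folklore] -/
def _root_.Literature.Computability.MetaComplexity.MonotoneDNF.BenalohLeichter.rbit (φ : MonotoneDNF) (r : BenalohLeichter.Rand φ) (k p : ℕ) : Bool :=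
  if h : k < φ.length ∧ p < φ.numLiterals then r (⟨k, h.1⟩, ⟨p, h.2⟩) else false

/-- The mask of term `k`: the `𝔽₂`-sum of its coins at positions `1 ≤ p < |φ[k]|`. [cite: Hirahara2022PartialMCSP, Lemma 4.5] -/
def _root_.Literature.Computability.MetaComplexity.MonotoneDNF.BenalohLeichter.mask (φ : MonotoneDNF) (r : BenalohLeichter.Rand φ) (k : ℕ) : ZMod 2 :=
  ∑ p ∈ Finset.Ico 1 (φ.termLen k), bitZ (BenalohLeichter.rbit φ r k p)

/-- The share symbol at occurrence `(k, p)` (Benaloh–Leichter: an AND gate is additive sharing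
over `𝔽₂`, an OR gate is replication): position `0` of term `k` carries
`b + Σ_{1 ≤ q < |φ[k]|} r_{k,q}`, position `p ≥ 1` carries the coin `r_{k,p}`; the symbols of
a term sum to the secret `b` (`sum_symbol_eq`). [cite: Hirahara2022PartialMCSP, Lemma 4.5] -/
def _root_.Literature.Computability.MetaComplexity.MonotoneDNF.BenalohLeichter.symbol (φ : MonotoneDNF) (b : Bool) (r : BenalohLeichter.Rand φ) (kp : ℕ × ℕ) : ZMod 2 :=
  if kp.2 = 0 then bitZ b + BenalohLeichter.mask φ r kp.1 else bitZ (BenalohLeichter.rbit φ r kp.1 kp.2)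

/-- **Share**: party `i` receives the symbols at the occurrences of the variable `i`, in
lexicographic order (so `|sᵢ|` is the number of occurrences of `i`, at most `|φ|`,
`length_share_le`). [cite: Hirahara2022PartialMCSP, Lemma 4.5] -/
def _root_.Literature.Computability.MetaComplexity.MonotoneDNF.BenalohLeichter.share (φ : MonotoneDNF) (b : Bool) (r : BenalohLeichter.Rand φ) (i : ℕ) : List Bool :=
  (φ.occsOf i).map fun kp => zBit (BenalohLeichter.symbol φ b r kp)

/-- The share bit of occurrence `(k, p)` read off a share vector `s`: the entry of the share of
the variable `φ[k][p]` at the rank of `(k, p)` among the occurrences of that variable.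
[cite: Hirahara2022PartialMCSP, Lemma 4.5] -/
def _root_.Literature.Computability.MetaComplexity.MonotoneDNF.BenalohLeichter.lookup (φ : MonotoneDNF) (s : ℕ → List Bool) (kp : ℕ × ℕ) : Bool :=
  (s (φ.varAt kp)).getD ((φ.occsOf (φ.varAt kp)).idxOf kp) false

/-- The index of the first term all of whose variables lie in `T` (`|φ|` if none). [folklore] -/
def _root_.Literature.Computability.MetaComplexity.MonotoneDNF.BenalohLeichter.firstTerm (φ : MonotoneDNF) (T : Finset ℕ) : ℕ :=
  φ.findIdx fun t => t.all fun i => decide (i ∈ T)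

/-- **Rec**: the set `T` picks the first term of `φ` contained in `T` and outputs the
`𝔽₂`-sum (XOR) of the share bits of that term's occurrences — a linear function of `s_T` over
`GF(2)` (`reconstruct_linear`). [cite: Hirahara2022PartialMCSP, Lemma 4.5] -/
def _root_.Literature.Computability.MetaComplexity.MonotoneDNF.BenalohLeichter.reconstruct (φ : MonotoneDNF) (T : Finset ℕ) (s : ℕ → List Bool) : Bool :=
  zBit (∑ p ∈ Finset.range (φ.termLen (BenalohLeichter.firstTerm φ T)), bitZ (BenalohLeichter.lookup φ s (BenalohLeichter.firstTerm φ T, p)))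

end BenalohLeichter

open MetaComplexity.MonotoneDNF.BenalohLeichter in
/-- **The Benaloh–Leichter secret sharing scheme of a monotone DNF formula** `φ` (Benaloh and
Leichter 1988; Ito, Saito and Nishizeki 1993; Hirahara 2022, Lemma 4.5, case of DNF formulas):
coins `BenalohLeichter.Rand φ`, sharing `BenalohLeichter.share φ`, reconstruction
`BenalohLeichter.reconstruct φ`. [cite: Hirahara2022PartialMCSP, Lemma 4.5] -/
def _root_.Literature.Computability.MetaComplexity.MonotoneDNF.blScheme (φ : MonotoneDNF) : SecretSharingScheme ℕ where
  Rand := BenalohLeichter.Rand φ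
  share := share φ
  reconstruct := reconstruct φ

section BenalohLeichter
open Literature.Computability.MetaComplexity.MonotoneDNF.BenalohLeichter

/-- The symbols of the occurrences of a (nonempty) term sum to the secret. [cite: Hirahara2022PartialMCSP, Lemma 4.5] -/
theorem _root_.Literature.Computability.MetaComplexity.MonotoneDNF.BenalohLeichter.sum_symbol_eq (φ : MonotoneDNF) (b : Bool) (r : BenalohLeichter.Rand φ) (k : ℕ) (hk : 0 < φ.termLen k) :
    ∑ p ∈ Finset.range (φ.termLen k), symbol φ b r (k, p) = bitZ b := by
  rw [Finset.range_eq_Ico, Finset.sum_eq_sum_Ico_succ_bot hk]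
  have h1 : ∑ p ∈ Finset.Ico (0 + 1) (φ.termLen k), symbol φ b r (k, p) = mask φ r k := by
    unfold mask
    refine Finset.sum_congr rfl fun p hp => ?_
    have hp1 : p ≠ 0 := by
      have := (Finset.mem_Ico.1 hp).1
      omega
    simp [symbol, hp1]
  rw [h1]
  show (if (0 : ℕ) = 0 then bitZ b + mask φ r k else bitZ (rbit φ r k 0)) + mask φ r k = bitZ b
  rw [if_pos rfl, add_assoc, CharTwo.add_self_eq_zero, add_zero]

/-- If `T` is authorized, the first term contained in `T` exists and is contained in `T`. [folklore] -/
theorem _root_.Literature.Computability.MetaComplexity.MonotoneDNF.BenalohLeichter.firstTerm_spec (φ : MonotoneDNF) {T : Finset ℕ}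
    (hT : T ∈ φ.accessStructure.authorized) :
    firstTerm φ T < φ.length ∧
      ∀ p < φ.termLen (firstTerm φ T), φ.varAt (firstTerm φ T, p) ∈ T := by
  obtain ⟨t, ht, htT⟩ := hT
  have hex : ∃ t ∈ φ, (fun t : List ℕ => t.all fun i => decide (i ∈ T)) t = true :=
    ⟨t, ht, by simpa [List.all_eq_true] using htT⟩
  have hlt : firstTerm φ T < φ.length := List.findIdx_lt_length_of_exists hex
  refine ⟨hlt, fun p hp => ?_⟩
  have hall := List.findIdx_getElem (w := hlt)
  simp only [List.all_eq_true, decide_eq_true_eq] at hall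
  have hget : φ.getD (firstTerm φ T) [] = φ[firstTerm φ T] := List.getD_eq_getElem _ _ hlt
  unfold termLen at hp
  rw [hget] at hp
  unfold varAt
  simp only
  rw [hget, List.getD_eq_getElem _ _ hp]
  exact hall _ (List.getElem_mem hp)

/-- Reading an occurrence's bit off the (unrestricted) shares gives its symbol. [cite: Hirahara2022PartialMCSP, Lemma 4.5] -/
theorem _root_.Literature.Computability.MetaComplexity.MonotoneDNF.BenalohLeichter.lookup_share (φ : MonotoneDNF) (b : Bool) (r : BenalohLeichter.Rand φ) {kp : ℕ × ℕ}
    (hkp : kp ∈ φ.occs) : lookup φ (share φ b r) kp = zBit (symbol φ b r kp) := by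
  have hmem : kp ∈ φ.occsOf (φ.varAt kp) := by
    rw [mem_occsOf]
    exact ⟨(mem_occs φ kp).1 hkp, rfl⟩
  unfold lookup share
  rw [List.getD_eq_getElem?_getD, List.getElem?_map, List.getElem?_idxOf hmem]
  rfl

/-- **Correctness of the Benaloh–Leichter scheme** (for a DNF without the empty term — a
formula over literals; the empty conjunction would make every set, including `∅`, authorized).
[cite: Hirahara2022PartialMCSP, Lemma 4.5 (with Def. 4.4, Correctness)] -/
theorem _root_.Literature.Computability.MetaComplexity.MonotoneDNF.BenalohLeichter.correct (φ : MonotoneDNF) (hφ : [] ∉ φ) : (blScheme φ).Correct φ.accessStructure := by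
  intro T hT b r
  obtain ⟨hlt, hin⟩ := firstTerm_spec φ hT
  change reconstruct φ T (restrictShares T (share φ b r)) = b
  unfold reconstruct
  have hsum : ∑ p ∈ Finset.range (φ.termLen (firstTerm φ T)),
      bitZ (lookup φ (restrictShares T (share φ b r)) (firstTerm φ T, p)) =
      ∑ p ∈ Finset.range (φ.termLen (firstTerm φ T)), symbol φ b r (firstTerm φ T, p) := by
    refine Finset.sum_congr rfl fun p hp => ?_
    have hp' : p < φ.termLen (firstTerm φ T) := Finset.mem_range.1 hp
    have hocc : (firstTerm φ T, p) ∈ φ.occs := (mem_occs φ _).2 ⟨hlt, hp'⟩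
    have hrestr : lookup φ (restrictShares T (share φ b r)) (firstTerm φ T, p) =
        lookup φ (share φ b r) (firstTerm φ T, p) := by
      unfold lookup
      rw [restrictShares_of_mem _ (hin p hp')]
    rw [hrestr, lookup_share φ b r hocc, bitZ_zBit]
  rw [hsum, sum_symbol_eq φ b r _ (termLen_pos φ hφ hlt), zBit_bitZ]

/-- The share of party `i` has one bit per occurrence of `i`. [cite: Hirahara2022PartialMCSP, Lemma 4.5] -/
theorem _root_.Literature.Computability.MetaComplexity.MonotoneDNF.BenalohLeichter.length_share (φ : MonotoneDNF) (b : Bool) (r : BenalohLeichter.Rand φ) (i : ℕ) :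
    (share φ b r i).length = (φ.occsOf i).length := by
  simp [share]

/-- **Share length** (Lemma 4.5: "the length `|sᵢ|` of each share is at most the number `|φ|`
of the literals in `φ`"). [cite: Hirahara2022PartialMCSP, Lemma 4.5] -/
theorem _root_.Literature.Computability.MetaComplexity.MonotoneDNF.BenalohLeichter.length_share_le (φ : MonotoneDNF) (b : Bool) (r : BenalohLeichter.Rand φ) (i : ℕ) :
    (share φ b r i).length ≤ φ.numLiterals :=
  (length_share φ b r i).trans_le (length_occsOf_le φ i)

/-- **Linearity of Rec** (Lemma 4.5: "for each fixed `φ` and `T`, `Rec(φ, T, -)` computes a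
linear function of `s_T` over `GF(2)`"): there is a list `L` of (party, bit position) pairs
with parties in `T` such that `Rec(φ, T, s)` is the `𝔽₂`-sum of the bits `s_i[q]`, `(i, q) ∈ L`
(missing bits read as `0`). [cite: Hirahara2022PartialMCSP, Lemma 4.5] -/
theorem _root_.Literature.Computability.MetaComplexity.MonotoneDNF.BenalohLeichter.reconstruct_linear (φ : MonotoneDNF) (T : Finset ℕ) :
    ∃ L : List (ℕ × ℕ), (∀ x ∈ L, x.1 ∈ T) ∧
      ∀ s : ℕ → List Bool, bitZ (reconstruct φ T s) = (L.map fun x => bitZ ((s x.1).getD x.2 false)).sum := by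
  by_cases hT : T ∈ φ.accessStructure.authorized
  · obtain ⟨hlt, hin⟩ := firstTerm_spec φ hT
    refine ⟨(List.range (φ.termLen (firstTerm φ T))).map fun p =>
      (φ.varAt (firstTerm φ T, p), (φ.occsOf (φ.varAt (firstTerm φ T, p))).idxOf (firstTerm φ T, p)),
      ?_, fun s => ?_⟩
    · intro x hx
      obtain ⟨p, hp, rfl⟩ := List.mem_map.1 hx
      exact hin p (List.mem_range.1 hp)
    · rw [reconstruct, bitZ_zBit, List.map_map, sum_map_range_eq_finset_sum]
      rfl
  · -- no term is contained in `T`: the first such term does not exist, the sum is empty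
    have hnone : firstTerm φ T = φ.length := by
      unfold firstTerm
      refine List.findIdx_eq_length.2 fun t ht => ?_
      by_contra hne
      have hall : (t.all fun i => decide (i ∈ T)) = true := by simpa using hne
      refine hT ⟨t, ht, fun i hi => ?_⟩
      simpa using List.all_eq_true.1 hall i hi
    have hlen : φ.termLen (firstTerm φ T) = 0 := by
      rw [hnone]
      simp [termLen]
    refine ⟨[], by simp, fun s => ?_⟩
    rw [reconstruct, hlen]
    simp

/-! #### Privacy: the coin bijection -/

/-- For an unauthorized `T`, the first position of term `k` holding a variable outside `T`. [folklore] -/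
def _root_.Literature.Computability.MetaComplexity.MonotoneDNF.BenalohLeichter.badPos (φ : MonotoneDNF) (T : Finset ℕ) (k : ℕ) : ℕ :=
  (φ.getD k []).findIdx fun i => !decide (i ∈ T)

/-- For an unauthorized `T`, every term has a position outside `T`, and `badPos` is one. [folklore] -/
theorem _root_.Literature.Computability.MetaComplexity.MonotoneDNF.BenalohLeichter.badPos_spec (φ : MonotoneDNF) {T : Finset ℕ} (hT : T ∉ φ.accessStructure.authorized)
    {k : ℕ} (hk : k < φ.length) :
    badPos φ T k < φ.termLen k ∧ φ.varAt (k, badPos φ T k) ∉ T := by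
  have hget : φ.getD k [] = φ[k] := List.getD_eq_getElem _ _ hk
  have hex : ∃ i ∈ φ[k], (fun i => !decide (i ∈ T)) i = true := by
    by_contra hcon
    refine hT ⟨φ[k], List.getElem_mem hk, fun i hi => ?_⟩
    by_contra hiT
    exact hcon ⟨i, hi, by simpa using hiT⟩
  have hlt : badPos φ T k < φ[k].length := by
    unfold badPos
    rw [hget]
    exact List.findIdx_lt_length_of_exists hex
  refine ⟨by unfold termLen; rwa [hget], ?_⟩
  have hb := List.findIdx_getElem (xs := φ[k]) (p := fun i => !decide (i ∈ T))
    (w := by unfold badPos at hlt; rwa [hget] at hlt)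
  unfold varAt badPos
  simp only
  rw [hget, List.getD_eq_getElem _ _ (by unfold badPos at hlt; rwa [hget] at hlt)]
  simpa using hb

/-- The coin involution: flip, in every term, the coin at the bad position. [cite: Hirahara2022PartialMCSP, Lemma 4.5 (privacy)] -/
def _root_.Literature.Computability.MetaComplexity.MonotoneDNF.BenalohLeichter.flip (φ : MonotoneDNF) (T : Finset ℕ) (r : BenalohLeichter.Rand φ) : BenalohLeichter.Rand φ :=
  fun kq => if kq.2.val = badPos φ T kq.1.val then !r kq else r kq

/-- `flip` is an involution. [folklore] -/
theorem _root_.Literature.Computability.MetaComplexity.MonotoneDNF.BenalohLeichter.flip_flip (φ : MonotoneDNF) (T : Finset ℕ) (r : BenalohLeichter.Rand φ) : flip φ T (flip φ T r) = r := by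
  funext kq
  unfold BenalohLeichter.flip
  split_ifs <;> simp

/-- `flip` as a bijection of the coin space. [folklore] -/
def _root_.Literature.Computability.MetaComplexity.MonotoneDNF.BenalohLeichter.flipEquiv (φ : MonotoneDNF) (T : Finset ℕ) : BenalohLeichter.Rand φ ≃ BenalohLeichter.Rand φ where
  toFun := flip φ T
  invFun := flip φ T
  left_inv := BenalohLeichter.flip_flip φ T
  right_inv := BenalohLeichter.flip_flip φ T

/-- The coins after flipping: only the bad positions of genuine terms change. [folklore] -/
theorem _root_.Literature.Computability.MetaComplexity.MonotoneDNF.BenalohLeichter.rbit_flip (φ : MonotoneDNF) (T : Finset ℕ) (r : BenalohLeichter.Rand φ) (k p : ℕ)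
    (hp : p < φ.numLiterals) :
    rbit φ (flip φ T r) k p =
      if k < φ.length ∧ p = badPos φ T k then !rbit φ r k p else rbit φ r k p := by
  unfold rbit BenalohLeichter.flip
  by_cases hk : k < φ.length
  · simp only [hk, hp, and_self, dif_pos, true_and]
  · simp [hk]

/-- Flipping the bad coin of a term adds `1` to its mask when the bad position is `≥ 1`, and
leaves the mask unchanged when it is `0`. [cite: Hirahara2022PartialMCSP, Lemma 4.5 (privacy)] -/
theorem _root_.Literature.Computability.MetaComplexity.MonotoneDNF.BenalohLeichter.mask_flip (φ : MonotoneDNF) (T : Finset ℕ) (r : BenalohLeichter.Rand φ) {k : ℕ} (hk : k < φ.length) :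
    mask φ (flip φ T r) k =
      mask φ r k + if badPos φ T k ∈ Finset.Ico 1 (φ.termLen k) then 1 else 0 := by
  unfold mask
  rw [← Finset.sum_ite_eq' (Finset.Ico 1 (φ.termLen k)) (badPos φ T k) (fun _ => (1 : ZMod 2)),
    ← Finset.sum_add_distrib]
  refine Finset.sum_congr rfl fun p hp => ?_
  have hpN : p < φ.numLiterals :=
    lt_of_lt_of_le (Finset.mem_Ico.1 hp).2 (termLen_le_numLiterals φ k)
  rw [rbit_flip φ T r k p hpN]
  by_cases hpb : p = badPos φ T k
  · subst hpb
    simp [hk, bitZ_not]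
  · simp [hpb]

/-- On the occurrences visible to an unauthorized `T`, sharing `0` with flipped coins shows the
same symbols as sharing `1`. [cite: Hirahara2022PartialMCSP, Lemma 4.5 (privacy)] -/
theorem _root_.Literature.Computability.MetaComplexity.MonotoneDNF.BenalohLeichter.symbol_flip (φ : MonotoneDNF) {T : Finset ℕ} (hT : T ∉ φ.accessStructure.authorized)
    (r : BenalohLeichter.Rand φ) {kp : ℕ × ℕ} (hkp : kp ∈ φ.occs) (hin : φ.varAt kp ∈ T) :
    symbol φ false (flip φ T r) kp = symbol φ true r kp := by
  obtain ⟨k, p⟩ := kp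
  obtain ⟨hk, hp⟩ := (mem_occs φ _).1 hkp
  obtain ⟨hblt, hbout⟩ := badPos_spec φ hT hk
  have hne : p ≠ badPos φ T k := by
    rintro rfl
    exact hbout hin
  unfold symbol
  by_cases hp0 : p = 0
  · subst hp0
    have hb1 : badPos φ T k ∈ Finset.Ico 1 (φ.termLen k) := by
      rw [Finset.mem_Ico]
      exact ⟨Nat.one_le_iff_ne_zero.2 (fun h => hne h.symm), hblt⟩
    simp only [if_true, bitZ_false, bitZ_true, zero_add]
    rw [mask_flip φ T r hk, if_pos hb1, add_comm]
  · simp only [hp0, if_false]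
    have hpN : p < φ.numLiterals := lt_of_lt_of_le hp (termLen_le_numLiterals φ k)
    rw [rbit_flip φ T r k p hpN, if_neg]
    exact fun h => hne h.2

/-- **Privacy of the Benaloh–Leichter scheme**: for an unauthorized `T`, the coin involution
`flip` transports the view `Share(1)_T` to `Share(0)_T`, so the two are identically
distributed. [cite: Hirahara2022PartialMCSP, Lemma 4.5 (with Def. 4.4, Privacy)] -/
theorem _root_.Literature.Computability.MetaComplexity.MonotoneDNF.BenalohLeichter.private_ (φ : MonotoneDNF) : (blScheme φ).Private φ.accessStructure := by
  refine (blScheme φ).private_of_equiv _ fun T hT => ⟨flipEquiv φ T, fun r => ?_⟩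
  change restrictShares T (share φ false (flip φ T r)) = restrictShares T (share φ true r)
  rw [restrictShares_eq_iff]
  intro i hi
  unfold share
  refine List.map_congr_left fun kp hkp => ?_
  obtain ⟨hocc, hvar⟩ := (mem_occsOf φ i kp).1 hkp
  rw [symbol_flip φ hT r ((mem_occs φ kp).2 hocc) (hvar ▸ hi)]

/-- The Benaloh–Leichter scheme is a secret sharing scheme for the access structure of `φ`
(no empty term). [cite: Hirahara2022PartialMCSP, Lemma 4.5] -/
theorem _root_.Literature.Computability.MetaComplexity.MonotoneDNF.BenalohLeichter.isSchemeFor (φ : MonotoneDNF) (hφ : [] ∉ φ) :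
    (blScheme φ).IsSchemeFor φ.accessStructure :=
  ⟨correct φ hφ, private_ φ⟩

end BenalohLeichter

/-- **Hirahara 2022, Lemma 4.5 (Ito–Saito–Nishizeki 1993; Benaloh–Leichter 1988), for monotone
DNF formulas.** Printed: for the family of access structures `𝒜_φ` represented by monotone
formulas `φ` there are a randomized polynomial-time `Share` and a deterministic polynomial-time
`Rec` such that `(Share(φ, -), Rec(φ, -))` is a secret sharing scheme for `𝒜_φ`; each share has
length `|sᵢ| ≤ |φ|` (the number of literals of `φ`); and for fixed `φ, T`, `Rec(φ, T, -)` is a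
linear function of `s_T` over `GF(2)`. Proved here for monotone **DNF** formulas (the formulas
of the CMMSA instances of Thm. 5.2 / `gapCMMSA`, to which Lemma 8.3 applies it), with the
explicit Benaloh–Leichter scheme `blScheme φ`: correctness and perfect privacy
(`IsSchemeFor`), the share-length bound, and linearity of reconstruction. The hypothesis
`[] ∉ φ` excludes the empty conjunction (a formula over literals has none; with it `∅` would be
authorized and no scheme can be correct). The running-time clauses are witnessed by the explicit
maps `BenalohLeichter.share`/`reconstruct` (one pass over the occurrences of `φ`) and are not restated
as Turing-machine bounds. [cite: Hirahara2022PartialMCSP, Lemma 4.5] -/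
theorem _root_.Literature.Computability.MetaComplexity.MonotoneDNF.exists_secretSharingScheme (φ : MonotoneDNF) (hφ : [] ∉ φ) :
    ∃ S : SecretSharingScheme ℕ, S.IsSchemeFor φ.accessStructure ∧
      (∀ b r i, (S.share b r i).length ≤ φ.numLiterals) ∧
      ∀ T : Finset ℕ, ∃ L : List (ℕ × ℕ), (∀ x ∈ L, x.1 ∈ T) ∧
        ∀ s : ℕ → List Bool,
          bitZ (S.reconstruct T s) = (L.map fun x => bitZ ((s x.1).getD x.2 false)).sum :=
  ⟨blScheme φ, BenalohLeichter.isSchemeFor φ hφ, BenalohLeichter.length_share_le φ,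
    BenalohLeichter.reconstruct_linear φ⟩

end MonotoneDNF

end Literature.Computability.Cryptography
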